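import Mathlib
import Literature.NumberTheory.DiophantineGeometry.SquarefulSums
import HarnessLib

/-!
# ABCOnSquares

Topic `Literature/Uncategorized`. Named literature fact(s) relocated by the gate from `Summits/ABC/ABC/Theorems/SoloBlindPythagorean.lean`
(accept-time relocation of `[cite]`d propositions written inline in a Summits proposal; human ruling 2026-08-15).

* `Literature.Uncategorized.ABCOnPowerful`
* `Literature.Uncategorized.ABCOnSquares`
-/

namespace Literature.Uncategorized

open UniqueFactorizationMonoid
open Literature.NumberTheory.DiophantineGeometry

/-- abc restricted to abc triples of three squares `(x², y², z²)` — primitive Pythagorean triples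
read as abc triples. [folklore] -/
def ABCOnSquares : Prop :=
  ∀ ε : ℝ, 0 < ε → ∃ C : ℝ, 0 < C ∧ ∀ a b c : ℕ, IsABCTriple a b c →
    (∃ x : ℕ, a = x ^ 2) → (∃ y : ℕ, b = y ^ 2) → (∃ z : ℕ, c = z ^ 2) →
      (c : ℝ) < C * ((rad a b c : ℕ) : ℝ) ^ (1 + ε)

/-- abc restricted to abc triples of powerful (squareful) numbers: `p ∣ a → p² ∣ a`, and likewise
for `b` and `c`. [folklore] -/
def ABCOnPowerful : Prop :=
  ∀ ε : ℝ, 0 < ε → ∃ C : ℝ, 0 < C ∧ ∀ a b c : ℕ, IsABCTriple a b c →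
    IsPowerful 2 a → IsPowerful 2 b → IsPowerful 2 c →
      (c : ℝ) < C * ((rad a b c : ℕ) : ℝ) ^ (1 + ε)

end Literature.Uncategorized
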